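import Summits.QuantumFields.BalabanUV.Beta.SecondOrderSeparation

/-!
# `BalabanUV.Beta.SecondOrderSeparationMixed` — binder row D1, the W-side (L4) of hR, leaf (W-REM-LOC-LIT), part 2: the MIXED slot —
# `mixOfK K N Rᴹ b c` and its swapped order `mixOfK K N Rᴹ c b` of a `LocStencilFM` remainder are bi-localised at the dilated first bond
# `(N•y, N•y)` with a constant decaying in `|N•y − N•y′|`; plus the re-centring tool paid from separation decay
# (β sub-cell, D1 formalisation swarm seat `b2b-balaban-beta-d1-formalise-leaf-05`, gen 5; plan journal l.11904)

HONEST FRAMING (cell contract, verbatim): «discharging `BetaPertH` makes Bałaban's UV stability UNCONDITIONAL — a real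
constructive-QFT result; it is NOT the continuum limit and NOT the Clay problem.»  HONEST DEPENDENCY (verbatim): «continuum YM on T⁴ ⇐
BetaPertH ∧ nine spine estimates (0/9 proved); BetaPertH ⇐ (D1) ∧ (D4) ∧ CAP+tail; G-an2-4 gates asym, D1 and NE2/3/4.»  [folklore]
analysis bookkeeping; no statement of Bałaban's papers, no `[cite:]` tag, no `def`, no `Prop` fact; instantiates NO binder of the β-function
wall; NOT D1, NOT `BetaPertH`, NOT continuum, NOT Clay.  ABSOLUTE RULE (cell, verbatim): «No internally-minted statement may enter as a cited
fact. Every hypothesis is either kernel-proved in this package or a verbatim quotation of a PUBLISHED theorem with page reference. The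
manuscript(s) under audit are NOT citable for their own disputed steps — they are the thing under adjudication; programme-internal
(2001/route/tribunal) claims are never citable.»  Nothing is cited here.

## What is proved (generic `d`, `N ≥ 1` via `[NeZero N]`, kernel `K`)

* §1 `biLoc_cwsum_fixed` (coarse-indexed twin of part 1's `biLoc_wsum_fixed`), `biLoc_innerReadM` (the mixed inner read
  `vertexOfM K N (Rᴹ κ u) ν y′` of a `LocStencilFM` table is bi-localised at `(u, u)` with constant `∝ e^{−(m/2)|u − N•y′|}`),
  **`biLoc_mixOfK_sep`**: `BiLoc (mixOfK K N Rᴹ μ y ν y′) (N•y) (N•y) (C′·e^{−(m/4)|N•y − N•y′|}) (3m/8)`.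
* §2 `biLoc_recenter_same` (re-centre both legs from `q` to `p`, paid by `e^{−3δ|p−q|}` of the constant), **`biLoc_mixOfK_swap_sep`**:
  the swapped order `mixOfK K N Rᴹ ν y′ μ y` is ALSO bi-localised at `(N•y, N•y)` with constant `∝ e^{−(m/12)|N•y − N•y′|}` (rate `m/12`).
Provenance: b2b-balaban β sub-cell, D1 formalisation swarm leaf-05 gen 5, 2026-08-20 (v1); no existing file touched.
-/

noncomputable section

open Finset
open scoped BigOperators
open Literature.MathematicalPhysics.QuantumFieldTheory
open Literature.MathematicalPhysics.QuantumFieldTheory.Balaban1983to89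
open Literature.MathematicalPhysics.QuantumFieldTheory.Balaban1983to89.Beta
open B12Sec2to5 (l1 l1_nonneg)
open ExpKernelCalculus (MKer Site Decays BiLoc Zl Zl_nonneg l1_sub_symm)
open Literature.Probability.LatticeModels (Torus.proj)
open LatticeForm (quo)
open OneStepResolventKernel (Fib wsum biLoc_finset_sum biLoc_mono eq_zsmul_quo_of_proj)
open OneStepKernelFamily (colH vertexOfK abs_colH_le)
open InterLevelTransport (cwsum onLat onLat_off)
open SecondOrderResponse (colM vertexOfM mixOfK LocStencilFM abs_colM_le biLoc_recenter_left biLoc_recenter_right)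
open BalabanStepW2 (biLoc_le_mono)
open Summit.QuantumFields.BalabanUV.Beta.SecondOrderSeparation

namespace Summit.QuantumFields.BalabanUV.Beta.SecondOrderSeparationMixed

variable {d N : ℕ}

/-! ## §1 The mixed slot, direct order -/

section Mixed

/-- [folklore] **COARSE SUPERPOSITION OF KERNELS LOCALISED AT ONE CENTRE**: weights `|w y| ≤ C·e^{−m|N•y − p|}`, kernels `Q y` bi-localised at
`(q, q)` at rate `δ` with constants `Ck·e^{−m|N•y − q|}` ⇒ `cwsum N w Q` is bi-localised at `(q, q)` at rate `δ`, constant `C·Ck·Zl(m/2)·e^{−(m/2)|q−p|}`. -/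
theorem biLoc_cwsum_fixed [NeZero N] {w : Site (d + 1) → ℝ} {Q : Site (d + 1) → MKer (d + 1) (Fib d)} {C Ck m δ : ℝ} {p q : Site (d + 1)}
    (hw : ∀ y, |w y| ≤ C * Real.exp (-m * l1 ((N : ℤ) • y - p))) (hQ : ∀ y, BiLoc (Q y) q q (Ck * Real.exp (-m * l1 ((N : ℤ) • y - q))) δ)
    (hm : 0 < m) (hC : 0 ≤ C) (hCk : 0 ≤ Ck) :
    BiLoc (cwsum N w Q) q q (C * Ck * Zl (d + 1) (m / 2) * Real.exp (-(m / 2) * l1 (q - p))) δ := by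
  unfold InterLevelTransport.cwsum
  refine biLoc_wsum_fixed (fun v => ?_) (fun v => ?_) hm hC hCk
  · by_cases hv : Torus.proj N v = 0
    · have e := eq_zsmul_quo_of_proj (N := N) hv
      simp only [onLat, hv, if_true]
      have h := hw (quo N v)
      rwa [← e] at h
    · rw [onLat_off w hv, abs_zero]
      positivity
  · by_cases hv : Torus.proj N v = 0
    · have e := eq_zsmul_quo_of_proj (N := N) hv
      simp only [onLat, hv, if_true]
      have h := hQ (quo N v)
      rwa [← e] at h
    · intro x z a b
      rw [onLat_off Q hv]
      show |(0 : ℝ)| ≤ _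
      rw [abs_zero]
      positivity

/-- [folklore] **THE SECOND-BOND MIXED READ OF A `LocStencilFM` TABLE IS LOCALISED AT THE FIRST BOND WITH SEPARATION DECAY**:
`vertexOfM K N (Rᴹ κ u) ν y′` is bi-localised at `(u, u)` (rate `m`), constant `(d+1)·C·Cᴹ·Zl(m/2)·e^{−(m/2)|u − N•y′|}`. -/
theorem biLoc_innerReadM [NeZero N] {K : MKer (d + 1) (Fib d)} {C m : ℝ} (hK : Decays K C m) (hm : 0 < m)
    {RM : Fin (d + 1) → (Fin (d + 1) → ℤ) → Fin (d + 1) → (Fin (d + 1) → ℤ) → MKer (d + 1) (Fib d)} {CM : ℝ} (hRM : LocStencilFM N RM CM m)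
    (κ : Fin (d + 1)) (u : Fin (d + 1) → ℤ) (ν : Fin (d + 1)) (y' : Fin (d + 1) → ℤ) :
    BiLoc (vertexOfM K N (RM κ u) ν y') u u
      ((d + 1 : ℕ) * (C * CM * Zl (d + 1) (m / 2) * Real.exp (-(m / 2) * l1 (u - (N : ℤ) • y')))) m := by
  have hC : 0 ≤ C := hK.nonneg (Sum.inl 0)
  have hCM : 0 ≤ CM := hRM.nonneg
  have hterm : ∀ ρ : Fin (d + 1), BiLoc (cwsum N (colM K N ν y' ρ) (RM κ u ρ)) u u
      (C * CM * Zl (d + 1) (m / 2) * Real.exp (-(m / 2) * l1 (u - (N : ℤ) • y'))) m := fun ρ =>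
    biLoc_cwsum_fixed (fun w => abs_colM_le (N := N) hK ν y' ρ w)
      (fun w => by
        have h := hRM κ u ρ w
        rwa [l1_sub_symm] at h) hm hC hCM
  have hsum := biLoc_finset_sum (Finset.univ : Finset (Fin (d + 1))) (fun ρ _ => hterm ρ)
  simp only [Finset.sum_const, Finset.card_univ, Fintype.card_fin, nsmul_eq_mul] at hsum
  exact hsum

/-- [folklore] **THE MIXED BI-VERTEX OF A LOCAL FIELD–MULTIPLIER REMAINDER IS LOCALISED AT THE DILATED FIRST BOND WITH SEPARATION DECAY**:
`Decays K C m`, `LocStencilFM N Rᴹ Cᴹ m` ⇒ `BiLoc (mixOfK K N Rᴹ μ y ν y′) (N•y) (N•y) (C′·e^{−(m/4)·l1 (N•y − N•y′)}) (3m/8)`. -/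
theorem biLoc_mixOfK_sep [NeZero N] {K : MKer (d + 1) (Fib d)} {C m : ℝ} (hK : Decays K C m) (hm : 0 < m)
    {RM : Fin (d + 1) → (Fin (d + 1) → ℤ) → Fin (d + 1) → (Fin (d + 1) → ℤ) → MKer (d + 1) (Fib d)} {CM : ℝ} (hRM : LocStencilFM N RM CM m)
    (μ : Fin (d + 1)) (y : Fin (d + 1) → ℤ) (ν : Fin (d + 1)) (y' : Fin (d + 1) → ℤ) :
    BiLoc (mixOfK K N RM μ y ν y') ((N : ℤ) • y) ((N : ℤ) • y)
      ((d + 1 : ℕ) * (C * ((d + 1 : ℕ) * (C * CM * Zl (d + 1) (m / 2))) * Zl (d + 1) (5 * m / 8) *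
        Real.exp (-(m / 4) * l1 ((N : ℤ) • y - (N : ℤ) • y')))) (3 * m / 8) := by
  have hC : 0 ≤ C := hK.nonneg (Sum.inl 0)
  have hCM : 0 ≤ CM := hRM.nonneg
  have hZ : 0 ≤ Zl (d + 1) (m / 2) := Zl_nonneg (half_pos hm)
  have hA : 0 ≤ (d + 1 : ℕ) * (C * CM * Zl (d + 1) (m / 2)) := by positivity
  have hin : ∀ (κ : Fin (d + 1)) (u : Fin (d + 1) → ℤ), BiLoc (vertexOfM K N (RM κ u) ν y') u u
      ((d + 1 : ℕ) * (C * CM * Zl (d + 1) (m / 2)) * Real.exp (-(m / 2) * l1 (u - (N : ℤ) • y'))) m := by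
    intro κ u
    have h := biLoc_innerReadM (N := N) hK hm hRM κ u ν y'
    rwa [← mul_assoc] at h
  have hterm : ∀ κ : Fin (d + 1), BiLoc (wsum (colH K N μ y κ) (fun u => vertexOfM K N (RM κ u) ν y')) ((N : ℤ) • y) ((N : ℤ) • y)
      (C * ((d + 1 : ℕ) * (C * CM * Zl (d + 1) (m / 2))) * Zl (d + 1) (5 * m / 8) *
        Real.exp (-(m / 4) * l1 ((N : ℤ) • y - (N : ℤ) • y'))) (3 * m / 8) := fun κ =>
    biLoc_wsum_outer (fun u => abs_colH_le (N := N) hK μ y κ u) (fun u => hin κ u) hm hC hA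
  have hsum := biLoc_finset_sum (Finset.univ : Finset (Fin (d + 1))) (fun κ _ => hterm κ)
  simp only [Finset.sum_const, Finset.card_univ, Fintype.card_fin, nsmul_eq_mul] at hsum
  exact hsum

end Mixed

/-! ## §2 Re-centring paid from separation decay; the swapped mixed slot -/

section Swap

/-- [folklore] **RE-CENTRING BOTH LEGS PAID FROM SEPARATION DECAY**: a kernel bi-localised at `(q, q)` (rate `δ ≥ 0`) with constant
`C·e^{−3δ|p−q|}` is bi-localised at `(p, p)` with constant `C·e^{−δ|p−q|}` (Literature `biLoc_recenter_left`∕`_right`, one `e^{−δ|p−q|}` each). -/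
theorem biLoc_recenter_same {D : ℕ} {F : Type*} {K : MKer D F} {p q : Site D} {C δ : ℝ}
    (h : BiLoc K q q (C * Real.exp (-(3 * δ) * l1 (p - q))) δ) (hC : 0 ≤ C) (hδ : 0 ≤ δ) :
    BiLoc K p p (C * Real.exp (-δ * l1 (p - q))) δ := by
  have e : C * Real.exp (-(3 * δ) * l1 (p - q)) = C * Real.exp (-δ * l1 (p - q)) * Real.exp (-δ * l1 (p - q)) * Real.exp (-δ * l1 (p - q)) := by
    rw [mul_assoc, mul_assoc, ← Real.exp_add, ← Real.exp_add]; congr 1; ring_nf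
  rw [e] at h
  have h1 : BiLoc K p q (C * Real.exp (-δ * l1 (p - q)) * Real.exp (-δ * l1 (p - q))) δ :=
    biLoc_recenter_left h (by positivity) hδ le_rfl
  exact biLoc_recenter_right h1 (by positivity) hδ le_rfl

/-- [folklore] **THE SWAPPED MIXED BI-VERTEX IS ALSO LOCALISED AT THE DILATED FIRST BOND** (with separation decay): `mixOfK K N Rᴹ ν y′ μ y` is
first bi-localised at `(N•y′, N•y′)` with constant `∝ e^{−(m/4)|N•y′ − N•y|}` (§1 with the bonds exchanged), then re-centred to `(N•y, N•y)`
at the cost of part of that decay: rate `m/12`, constant `∝ e^{−(m/12)|N•y − N•y′|}`. -/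
theorem biLoc_mixOfK_swap_sep [NeZero N] {K : MKer (d + 1) (Fib d)} {C m : ℝ} (hK : Decays K C m) (hm : 0 < m)
    {RM : Fin (d + 1) → (Fin (d + 1) → ℤ) → Fin (d + 1) → (Fin (d + 1) → ℤ) → MKer (d + 1) (Fib d)} {CM : ℝ} (hRM : LocStencilFM N RM CM m)
    (μ : Fin (d + 1)) (y : Fin (d + 1) → ℤ) (ν : Fin (d + 1)) (y' : Fin (d + 1) → ℤ) :
    BiLoc (mixOfK K N RM ν y' μ y) ((N : ℤ) • y) ((N : ℤ) • y)
      ((d + 1 : ℕ) * (C * ((d + 1 : ℕ) * (C * CM * Zl (d + 1) (m / 2))) * Zl (d + 1) (5 * m / 8)) *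
        Real.exp (-(m / 12) * l1 ((N : ℤ) • y - (N : ℤ) • y'))) (m / 12) := by
  have hC : 0 ≤ C := hK.nonneg (Sum.inl 0)
  have hCM : 0 ≤ CM := hRM.nonneg
  have hZ : 0 ≤ Zl (d + 1) (m / 2) := Zl_nonneg (half_pos hm)
  have hZ' : 0 ≤ Zl (d + 1) (5 * m / 8) := Zl_nonneg (by positivity)
  set B : ℝ := (d + 1 : ℕ) * (C * ((d + 1 : ℕ) * (C * CM * Zl (d + 1) (m / 2))) * Zl (d + 1) (5 * m / 8)) with hB_def
  have hB : 0 ≤ B := by positivity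
  -- §1 with the two bonds exchanged: localised at `(N•y', N•y')`, constant decaying in `|N•y' − N•y|`
  have h0 := biLoc_mixOfK_sep (N := N) hK hm hRM ν y' μ y
  have h1 : BiLoc (mixOfK K N RM ν y' μ y) ((N : ℤ) • y') ((N : ℤ) • y')
      (B * Real.exp (-(m / 4) * l1 ((N : ℤ) • y - (N : ℤ) • y'))) (3 * m / 8) := by
    rw [l1_sub_symm] at h0
    refine biLoc_le_mono h0 (by positivity) (le_of_eq ?_) le_rfl
    rw [hB_def]; ring
  -- weaken the rate to `m/12`; the constant's decay `e^{−(m/4)s} = e^{−3(m/12)s}` pays for re-centring both legs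
  have h2 : BiLoc (mixOfK K N RM ν y' μ y) ((N : ℤ) • y') ((N : ℤ) • y')
      (B * Real.exp (-(3 * (m / 12)) * l1 ((N : ℤ) • y - (N : ℤ) • y'))) (m / 12) := by
    rw [show -(3 * (m / 12)) = -(m / 4) by ring]
    exact biLoc_le_mono h1 (by positivity) le_rfl (by linarith)
  exact biLoc_recenter_same h2 hB (by positivity)

end Swap

end Summit.QuantumFields.BalabanUV.Beta.SecondOrderSeparationMixed

end
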